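import Summits.QuantumFields.YangMills.Theorems.AlphaInputsT3ACv3StepLow
import HarnessLib

/-!
# `AlphaInputsT3ACv3StepLowPrint` — PRINT'S VALIDITY FAMILY OF THE LOWER BOUND IN THE LANE'S LETTERS («R-57χ», owner RULING g23-№2 ADDENDA 4–5; the definer's letter
# choice c = 1 with the (4)-window conjunct = ★r1's `printChiSets` read at the lane's inputs) — lane `pub-balaban3d`, seat alpha-1 (g9)

`PinnedStep.loPrintAC 𝔎 X k := {(4)-window of level k} ∩ PinnedStep.chiMinAC 𝔎 X 1 k`: the fields in the small-field window `|V(∂p) − 1| < g_kp(g_k)` ((7) p.257) whose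
minimiser satisfies print's condition of (47) p.267 at window constant 1.  This is the validity family the χ-record `AlphaV3AC.StepAlphaV3ChiAC` displays its lower row on
(`AlphaInputsT3ACv3LaneChi`); at the T³ data it is ★r1's `LogComparisonRepAtHeightsOn.printChiSets` (p546995), so the 20520-side On-χ sockets consume the row by name, and every
FIELD-window reader of the lower bound (19936's denominator, E-INT's c-interior) enters through `plaqSmall_subset_loPrintAC` with [Balaban1985Variational] Thm 1 (8) (the record's
minimiser row r1) as `hreg`.  Why the field conjunct is harmless inside the fibre integral at constant 1 (the saddle of a datum of this family has level-`k` plaquettes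
`≲ L^{−3/2}·g_kp(g_k)`, [Balaban1985Averaging] Prop. 2) and why a larger minimiser constant would not be: seat memo `AUDIT-alpha-rows-alpha1-g9.md` N-1, owner ADDENDUM 5 (b).
Definitions + [folklore] set bookkeeping; nothing of [Balaban1985UV3] is asserted.

References: T. Bałaban, Commun. Math. Phys. 102 (1985) 255–275 [Balaban1985UV3] ((7) p.257, (47) p.267); Commun. Math. Phys. 102 (1985) 277–309 [Balaban1985Variational] (Thm 1 (8) p.279).
-/

set_option autoImplicit false

noncomputable section

/-! ## §0 Print's validity family in the lane's letters -/

namespace Summit.QuantumFields.YangMills.Theorems.PinnedStep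

open MeasureTheory
open Literature.MathematicalPhysics.QuantumFieldTheory.Balaban1983to89
open Literature.MathematicalPhysics.QuantumFieldTheory.Balaban1985CMP102
open Literature.MathematicalPhysics.QuantumFieldTheory.Balaban1985CMP102.Setting
open Summit.QuantumFields.Balaban3D.Carriers
open Summit.QuantumFields.Balaban3D.Proofs.Inputs (LaneConsts)
open Summit.QuantumFields.Balaban3D.Proofs.TowerAC
open Summit.QuantumFields.Balaban3D.Proofs.StandardAC
open Summit.QuantumFields.Balaban3D.Proofs.InputsAC

variable {L : ℕ} (𝔎 : LaneConsts L) {S : Scales L} {G : Type} [GaugeGroup G] [MeasurableSpace G] [HaarData G] (X : ExternalInputsAC S G)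

/-- **PRINT'S VALIDITY FAMILY OF THE LOWER BOUND, IN THE LANE'S LETTERS**: level `k` consists of the fields `V` in the (4)/(7)-window `|V(∂p) − 1| < g_kp(g_k)` whose minimiser
`U_k(V)` (the input's `ukAll X.Uk k V`) satisfies print's condition of (47) p.267, «|U_k(∂p) − 1| < g_kp(g_k)η², p ⊂ T_η» (window constant 1) — i.e. `{(4)-window} ∩ chiMinAC 𝔎 X 1 k`;
at the T³ data this is ★r1's `LogComparisonRepAtHeightsOn.printChiSets` (p546995) for `k ≤ K`.  The field clause is print's setting for the datum of a step ((7) p.257, (40) p.266)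
and keeps the family inside the window every envelope consumer integrates over; inside the fibre integral it is harmless at constant 1 (the saddle of a datum in this family has
level-`k` plaquettes `≲ L^{−3/2}·g_kp(g_k)`, [Balaban1985Averaging] Prop. 2; seat memo N-1). [cite: Balaban1985UV3, (7) p.257 + (47) p.267] -/
def loPrintAC (k : ℕ) : Set (GaugeField S.P k G) :=
  {V | PlaqSmall (eps1Of S 𝔎.carrier k) V} ∩ chiMinAC 𝔎 X 1 k

/-- Unfolding lemma. [cite: Balaban1985UV3, (47) p.267] -/
theorem mem_loPrintAC_iff (k : ℕ) (V : GaugeField S.P k G) :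
    V ∈ loPrintAC 𝔎 X k ↔ PlaqSmall (eps1Of S 𝔎.carrier k) V ∧ PlaqSmall (1 * eps1Of S 𝔎.carrier k * ((L : ℝ)⁻¹) ^ (2 * k)) (ukAll X.Uk k V) :=
  Iff.rfl

/-- Print's family lies inside the (4)-window of its level. [cite: Balaban1985UV3, (7) p.257] -/
theorem loPrintAC_subset_window (k : ℕ) : loPrintAC 𝔎 X k ⊆ {V | PlaqSmall (eps1Of S 𝔎.carrier k) V} := fun _ hV => hV.1

/-- Print's family lies inside print's minimiser window at constant 1. [cite: Balaban1985UV3, (47) p.267] -/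
theorem loPrintAC_subset_chiMinAC (k : ℕ) : loPrintAC 𝔎 X k ⊆ chiMinAC 𝔎 X 1 k := fun _ hV => hV.2

/-- **A SMALLER FIELD WINDOW WHOSE MINIMISERS ARE REGULAR LIES IN PRINT'S FAMILY**: if every `δ`-small field of level `k` has a `g_kp(g_k)η²`-regular minimiser (`hreg`; at the T³ data
with `δ := g_kp(g_k)/max(B₃,1)` this is [Balaban1985Variational] Thm 1 (8) = the record's minimiser row r1) and `δ ≤ g_kp(g_k)`, then the `δ`-window lies in `loPrintAC 𝔎 X k` — the
bridge every FIELD-window reader of the lower bound uses (19936's denominator on the interior window; E-INT's c-interior). [cite: Balaban1985Variational, Thm 1 (8) p.279] -/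
theorem plaqSmall_subset_loPrintAC (k : ℕ) {δ : ℝ} (hδ : δ ≤ eps1Of S 𝔎.carrier k)
    (hreg : ∀ V : GaugeField S.P k G, PlaqSmall δ V → PlaqSmall (eps1Of S 𝔎.carrier k * ((L : ℝ)⁻¹) ^ (2 * k)) (ukAll X.Uk k V)) :
    {V : GaugeField S.P k G | PlaqSmall δ V} ⊆ loPrintAC 𝔎 X k := by
  intro V hV
  refine ⟨fun p => (hV p).trans_le hδ, ?_⟩
  rw [mem_chiMinAC_iff, one_mul]
  exact hreg V hV

/-- Print's family is measurable whenever the composite minimiser at the trivial history is (row `hU`). [cite: Balaban1985UV3, (42) p.266] -/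
theorem measurableSet_loPrintAC [RegularGaugeGroup G] (k : ℕ) (hU : Measurable (X.UkH k (Hist.triv S.P k))) : MeasurableSet (loPrintAC 𝔎 X k) :=
  (T3UnitScaleTilt.measurableSet_plaqSmall _).inter (measurableSet_chiMinAC 𝔎 X 1 k hU)

end Summit.QuantumFields.YangMills.Theorems.PinnedStep

end
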